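import Summits.Ventures.CertifiedManyBodySolver.Theorems.M3x2EdgeSplitSymReplayPackedHB
import HarnessLib

/-!
# SymReplay checker — ORACLE v3 «moment-pruned canon» for the packed hinted pipe (unverified executable) + a table-free split key

(team lb-sym, cell hub-lb; engine item after crit-1 V157 «oracle v3 GO»; hub-lb-sym-eng-4 g2.  ADDITIVE: imports `…PackedHB`
only; nothing landed is touched.  Image numbering `k` and `gammaOfK` follow hub-lb-sym-ref-1's kernel v2 (`d4ab`, `γof`).)

WHY.  After the E4(b) packed bridge (`…PackedNF/NFBridge/PackedHB`) the ORACLE — the unverified function proposing the canonical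
image `(γ, v)` of each surviving word — was ≈ 80–90 % of the packed pipe (kernel v2 through the packed-input adapter: ≈ 125–245
µs/word interpreted).  E5's verified step accepts ANY hint; only CONSISTENCY of the selection across the certificate matters (all
words pass through the same oracle), so the selection rule is free.  v3 selects WITHOUT building images where it can.

WHAT.  `oracleV3 : PWord → PHint` on the E4 letter code of the box of record `[−12,12]²` (`c = 4·(25a + b) + tail`): ONE decode
pass gives the bounding box `amin amax bmin bmax`, the first moments `Σa, Σb` and the length; the eight anchored images then have
widths and first moments by O(1) arithmetic (`ov3Anch`/`ov3Corner` tables); the image is chosen by the preorder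
(width, ΣA′, ΣB′) and ONLY the images tied in that preorder are built (`ov3Image`: re-anchored codes, creation/annihilation
blocks insertion-sorted with parity) and compared by full key (`ov3Resolve`); a ZERO CLAIM (partner) is a tied image with the
same word and the opposite parity — every non-trivial stabiliser of the anchored point multiset preserves the preorder key, so
sign-odd classes are found exactly inside the tie class.  Output `PHint` = (`gammaOfK k`, `−corner_k`, partner likewise), consumed by
`…PackedHB.ppipeOKHBZ` / `oracleOfP`.  Also here: `kapDip`, a TABLE-FREE module split key `Word → ℕ` (charged words → 0;
neutral words keyed by the O(2)-invariants `u·u, v·v, u·v, (u×v)²` of the two spin dipoles) — invariant under normal ordering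
(a contracted `c c†` pair cancels in charge and dipole) and under `D₄ ×` translations on neutral words, so every output class of
the residual lies in one slot (no moment table needed when the spec share `shareR` is affordable).

MEASURED (interpreted `#eval` = gate mode, real rung-V data, STATUS 2026-08-28 hub-lb-sym-eng-4 g2): oracle alone v2 → v3
÷6–8 (20–27 µs/word); packed pipe on 20 000 block-0 products 4.3–4.5 s → 2.0–2.4 s; class partition under v3 ≡ under v2 and
zero claims equal on 20 818 real words; END-TO-END `ppipeOKHBZ lo hi oracleV3 (shareR cert kapDip 4 0) = true` on the complete
rung-V certificate (680 571 terms → 14 741 classes, all zero; pipe 55.5 s).  Soundness is untouched: a wrong oracle or key can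
only make a module Boolean `false`.

HONEST FRAMING: unverified executables for a checker COST lever; no certificate lands by this file; no bound of record moves; no
summit or crux statement is proved here; nothing here predicts superconductivity.
-/

namespace Summit.Ventures.CertifiedManyBodySolver.Theorems.SymReplay.PackedNF

open Literature.Probability.LatticeModels (Site)
open Summit.Ventures.CertifiedManyBodySolver.Theorems.SymReplay

/-- `k ↦ γ`: the point-group element realised by image `k` (hub-lb-sym-ref-1's kernel-v2 table). -/
def gammaOfK (k : ℕ) : DihedralGroup 4 :=
  match k with
  | 0 => .r 0 | 1 => .r 1 | 2 => .r 2 | 3 => .r 3 | 4 => .sr 0 | 5 => .sr 3 | 6 => .sr 2 | _ => .sr 1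

section OracleV3

/-- Pass 1: `(amin, amax, bmin, bmax, Σa, Σb, length)` of the decoded sites, and the decoded `(a, b, tail)` list (reversed). -/
def ov3Stats : List ℕ → ℕ → ℕ → ℕ → ℕ → ℕ → ℕ → ℕ → List (ℕ × ℕ × ℕ) →
    (ℕ × ℕ × ℕ × ℕ × ℕ × ℕ × ℕ) × List (ℕ × ℕ × ℕ)
  | [], amin, amax, bmin, bmax, sa, sb, n, acc => ((amin, amax, bmin, bmax, sa, sb, n), acc)
  | c :: w, amin, amax, bmin, bmax, sa, sb, n, acc =>
    let s := c / 4
    let a := s / 25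
    let b := s % 25
    ov3Stats w (min amin a) (max amax a) (min bmin b) (max bmax b) (sa + a) (sb + b) (n + 1) ((a, b, c % 4) :: acc)

/-- Anchored coordinates of a decoded site under image `k` (v2's `d4ab` numbering), given the word's bounding box. -/
@[inline] def ov3Anch (k amin amax bmin bmax a b : ℕ) : ℕ × ℕ :=
  match k with
  | 0 => (a - amin, b - bmin)
  | 1 => (bmax - b, a - amin)
  | 2 => (amax - a, bmax - b)
  | 3 => (b - bmin, amax - a)
  | 4 => (a - amin, bmax - b)
  | 5 => (b - bmin, a - amin)
  | 6 => (amax - a, b - bmin)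
  | _ => (bmax - b, amax - a)

/-- The min corner (box coordinates) of image `k` — the hint's translation is its negative. -/
@[inline] def ov3Corner (k amin amax bmin bmax : ℕ) : ℕ × ℕ :=
  match k with
  | 0 => (amin, bmin)
  | 1 => (24 - bmax, amin)
  | 2 => (24 - amax, 24 - bmax)
  | 3 => (bmin, 24 - amax)
  | 4 => (amin, 24 - bmax)
  | 5 => (bmin, amin)
  | 6 => (24 - amax, bmin)
  | _ => (24 - bmax, 24 - amax)

/-- Insert a code into an ascending list, flipping the parity once per element skipped. -/
def ov3Ins (c : ℕ) : List ℕ → Bool × List ℕ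
  | [] => (false, [c])
  | d :: l => if c ≤ d then (false, c :: d :: l) else let r := ov3Ins c l; (!r.1, d :: r.2)

/-- Image `k` of the decoded (reversed) letter list: sorted creation codes, sorted annihilation codes, parity of the two sorts. -/
def ov3Image (k amin amax bmin bmax : ℕ) : List (ℕ × ℕ × ℕ) → List ℕ × List ℕ × Bool
  | [] => ([], [], false)
  | (a, b, t) :: rest =>
    let r := ov3Image k amin amax bmin bmax rest
    let p := ov3Anch k amin amax bmin bmax a b
    let c := 4 * (25 * p.1 + p.2) + t
    if t % 2 == 0 then
      let i := ov3Ins c r.1; (i.2, r.2.1, xor r.2.2 i.1)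
    else
      let i := ov3Ins c r.2.1; (r.1, i.2, xor r.2.2 i.1)

/-- Lexicographic comparison of code lists (`Ordering`). -/
def ov3Cmp : List ℕ → List ℕ → Ordering
  | [], [] => .eq
  | [], _ :: _ => .lt
  | _ :: _, [] => .gt
  | a :: u, b :: v => if a < b then .lt else if b < a then .gt else ov3Cmp u v

/-- Compare two images by (creation block, annihilation block). -/
@[inline] def ov3CmpImg (x y : List ℕ × List ℕ × Bool) : Ordering :=
  match ov3Cmp x.1 y.1 with
  | .eq => ov3Cmp x.2.1 y.2.1
  | o => o

/-- Resolve a tie class `ks` (≥ 1 candidates): build their images, take the least by full key; partner = a tied image with the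
same word and the opposite parity (zero claim). Returns `(k, partner k?)`. -/
def ov3Resolve (amin amax bmin bmax : ℕ) (dec : List (ℕ × ℕ × ℕ)) (ks : List ℕ) : ℕ × Option ℕ :=
  match ks with
  | [] => (0, none)
  | k0 :: rest =>
    let img0 := ov3Image k0 amin amax bmin bmax dec
    -- fold: best (k, image), and a partner candidate for the current best
    let r := rest.foldl (fun (st : ℕ × (List ℕ × List ℕ × Bool) × Option ℕ) k =>
      let img := ov3Image k amin amax bmin bmax dec
      match ov3CmpImg img st.2.1 with
      | .lt => (k, img, none)            -- strictly smaller key: new best, partner search restarts (equal keys come later or were larger)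
      | .gt => st
      | .eq => if img.2.2 != st.2.1.2.2 then (st.1, st.2.1, some k) else st) (k0, img0, none)
    -- a partner found BEFORE a later strictly-smaller best was discarded by the restart; equal-key images seen before the
    -- final best cannot exist (the best is the least), so `r.2.2` is a valid partner for the final best when present.
    (r.1, r.2.2)

/-- **Oracle v3** (packed input in the E4 letter code, output a packed hint for `…PackedHB`). -/
def oracleV3 (w : PWord) : PHint :=
  let st := ov3Stats w 25 0 25 0 0 0 0 []
  let amin := st.1.1; let amax := st.1.2.1; let bmin := st.1.2.2.1; let bmax := st.1.2.2.2.1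
  let sa := st.1.2.2.2.2.1; let sb := st.1.2.2.2.2.2.1; let n := st.1.2.2.2.2.2.2
  let dec := st.2
  if n == 0 then ⟨.r 0, 0, 0, none⟩ else
  let wa := amax - amin; let wb := bmax - bmin
  let p := sa - n * amin; let p' := n * amax - sa; let q := sb - n * bmin; let q' := n * bmax - sb
  -- preorder key (width, ΣA′, ΣB′) packed into one number (ΣA′, ΣB′ ≤ 24·n < 2^12 for n ≤ 170)
  let key := fun (wd x y : ℕ) => (wd * 4096 + x) * 4096 + y
  let c0 := key wa p q;  let c1 := key wb q' p; let c2 := key wa p' q'; let c3 := key wb q p'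
  let c4 := key wa p q'; let c5 := key wb q p;  let c6 := key wa p' q;  let c7 := key wb q' p'
  let m := min (min (min c0 c1) (min c2 c3)) (min (min c4 c5) (min c6 c7))
  let ks := (if c7 == m then [7] else []) |> (fun l => if c6 == m then 6 :: l else l)
    |> (fun l => if c5 == m then 5 :: l else l) |> (fun l => if c4 == m then 4 :: l else l)
    |> (fun l => if c3 == m then 3 :: l else l) |> (fun l => if c2 == m then 2 :: l else l)
    |> (fun l => if c1 == m then 1 :: l else l) |> (fun l => if c0 == m then 0 :: l else l)
  let sel : ℕ × Option ℕ := match ks with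
    | [k] => (k, none)
    | _ => ov3Resolve amin amax bmin bmax dec ks
  let cor := ov3Corner sel.1 amin amax bmin bmax
  ⟨gammaOfK sel.1, -(cor.1 : ℤ), -(cor.2 : ℤ),
    sel.2.map fun k' => let c' := ov3Corner k' amin amax bmin bmax; (gammaOfK k', -(c'.1 : ℤ), -(c'.2 : ℤ))⟩

/-- Size of the tie class of the preorder (diagnostic). -/
def ov3TieSize (w : PWord) : ℕ :=
  let st := ov3Stats w 25 0 25 0 0 0 0 []
  let amin := st.1.1; let amax := st.1.2.1; let bmin := st.1.2.2.1; let bmax := st.1.2.2.2.1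
  let sa := st.1.2.2.2.2.1; let sb := st.1.2.2.2.2.2.1; let n := st.1.2.2.2.2.2.2
  let wa := amax - amin; let wb := bmax - bmin
  let p := sa - n * amin; let p' := n * amax - sa; let q := sb - n * bmin; let q' := n * bmax - sb
  let key := fun (wd x y : ℕ) => (wd * 4096 + x) * 4096 + y
  let cs := [key wa p q, key wb q' p, key wa p' q', key wb q p', key wa p q', key wb q p, key wa p' q, key wb q' p']
  let m := cs.foldl min (cs.headD 0)
  (cs.filter (· == m)).length

end OracleV3

/-! ## A table-free module split key (invariant under normal ordering and under `D₄ ×` translations on the residual) -/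

section SplitKey

/-- Accumulate `(q↑, q↓, d↑ₓ, d↑_y, d↓ₓ, d↓_y)`: net charge and dipole per spin (`+` for creators, `−` for annihilators). -/
def dipAcc : Word → ℤ → ℤ → ℤ → ℤ → ℤ → ℤ → ℤ × ℤ × ℤ × ℤ × ℤ × ℤ
  | [], qU, qD, ux, uy, vx, vy => (qU, qD, ux, uy, vx, vy)
  | ℓ :: w, qU, qD, ux, uy, vx, vy =>
    let sg : ℤ := if ℓ.dag then 1 else -1
    if ℓ.s.val == 0 then dipAcc w (qU + sg) qD (ux + sg * ℓ.x 0) (uy + sg * ℓ.x 1) vx vy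
    else dipAcc w qU (qD + sg) ux uy (vx + sg * ℓ.x 0) (vy + sg * ℓ.x 1)

/-- **Table-free split key**: charged words → `0`; neutral words → an `ℕ` built from the O(2)-invariants of the two spin
dipoles `u = d↑`, `v = d↓` (`u·u + 2 v·v + 3 u·v + 5 (u×v)²`).  Use as the `κ` of `shareR K κ J i`. -/
def kapDip (w : Word) : ℕ :=
  let d := dipAcc w 0 0 0 0 0 0
  let qU := d.1; let qD := d.2.1; let ux := d.2.2.1; let uy := d.2.2.2.1; let vx := d.2.2.2.2.1; let vy := d.2.2.2.2.2
  if qU != 0 || qD != 0 then 0 else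
    Int.natAbs (ux * ux + uy * uy + 2 * (vx * vx + vy * vy) + 3 * (ux * vx + uy * vy) + 5 * (ux * vy - uy * vx) * (ux * vy - uy * vx))

end SplitKey

end Summit.Ventures.CertifiedManyBodySolver.Theorems.SymReplay.PackedNF
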